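import Literature.MathematicalPhysics.QuantumFieldTheory.Balaban1983to89.B9Cor35GpCubeInputsAtOne
import Literature.MathematicalPhysics.QuantumFieldTheory.Balaban1983to89.B9Ineq349Hom
import Literature.MathematicalPhysics.QuantumFieldTheory.Balaban1983to89.B9Eq376POneLetters
import Literature.MathematicalPhysics.QuantumFieldTheory.Balaban1983to89.B9Eq357CubeLetters

/-!
# `Balaban1983to89.B9Cor36CubeSandwichQ` — THE CUBE SEQUENCE's BLOCK AVERAGINGS `Q′_□(U)`, `Q′_□*(U)` IN REAL COORDINATES OVER p33's CUBE GEOMETRY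
# `geoCK i □`: BLOCK-LOCAL TWO-SPACE MAJORANTS `𝟙[a = a′]·M₂Σ_j‖b_j‖`, AND THE `Q′_□( · )Q′_□*` SANDWICH — the binders `hQc`∕`hQcs` of r06's
# `B9Thm34InvBlk.thm34_Cinv_uniform_blk` (R-Ker-1) at the cube and the block majorant of `Q′_□G′_□²Q′_□*` from a site majorant of `G′_□²`
# (sub-row G-B9-LETTERS, module M5.2-E, FILE E2-4a; design (β) of `lit-balaban-p21/M52E-DESIGN-p21.md`)

T. Bałaban, *Propagators for lattice gauge theories in a background field*, Commun. Math. Phys. **99** (1985) 389–434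
[`Balaban1985BackgroundPropagators`, "B9"]; [4] = T. Bałaban, *Propagators and renormalization transformations for lattice gauge
theories. II*, Commun. Math. Phys. **96** (1984) 223–250 [`Balaban1984PropagatorsII`].

statement-level skeleton of published theorems with citation tags; proofs where landed; nothing here is a claim about the
Yang–Mills mass gap

THE PRINTED LOCUS (verbatim, held `paper:balaban1985-cmp99-background-propagators`, journal page = PDF page + 388).  (3.19) p. 393: *«(Q′_j(U)λ)(y) =
Σ_{x∈Bʲ(y)} L^{−jd}R(U(Γ_{y,x}))λ(x)»*; (3.21) p. 394; (3.24)–(3.25) p. 394 (the adjoint `Q′\*` and the letter `Q′G′²Q′\*`); p. 409 l. 2–5 (*«The operators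
constructed for this sequence, which we denote by G′_□(U), C_□(U) = (Q′(U)G′²_□(U)Q′\*(U))⁻¹, …»*); Thm 3.4 p. 400 with p. 403 (*«an inverse of the left-hand side can be
expressed by a Neumann series … The inverse satisfies Theorem 3.2»*); [4] (2.14) p. 225, (2.51)–(2.52) p. 232 (*«A composition of operators preserves the above
property»*), (2.69) p. 235.

WHY THIS FILE (cell `lit-balaban`; module M5.2-E allocated → p21 g34, `lit-balaban-r06/B9-LETTERS-MAP.md` §8).  r06's R-Ker-1 repair `B9Thm34InvBlk.thm34_Cinv_uniform_blk`
(p634302 ✓, INTERFACES-r06 §117) — Theorem 3.4's `(Q′G′²Q′\*)⁻¹(U′U)`-clause on an `𝔸`-VALUED block carrier `(P, blkP)` — takes the (3.19) letters as two-space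
majorants `hQc : HasMajorantHom (fun p => blk p.1) blkP Qc (κ𝟙)`, `hQcs : HasMajorantHom blkP (fun p => blk p.1) Qcs (κ𝟙)`.  At the CUBE SEQUENCE (FILE E2-4 of
M5.2-E: Theorem 3.2 for `(Q′_□G′_□²Q′_□\*)(Ṽ)` at the localised field) the geometry is p33's `B9CubeGeometryInputs.geoCK i □` (sites = r05's cube blocks
`BlkCubeY i □`, `d = d_T`), `blk = blkCubeY i □`, `P = BlkCubeY i □ × ι`, `blkP = Prod.fst`, and the letters are r05's `B9CubeLettersBondOpsL0.QpCubeY ∕ QpsCubeY`.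
THIS FILE is the cube twin of p21's member file `B9Thm39CinvSandwichQ` (same proofs, r05's kernels `qpKc ∕ qpsKc ∕ qpTc` for def-Y's `qpK ∕ qpsK ∕ qpT`):
* §1 the letters pointwise (r05's kernel facts `B9Eq357CubeLetters.qpKc_of_blkOf_eq ∕ _ne` by name): block-locality and contraction (`QpCubeY_apply_eq_zero_of`, `sum_abs_qpKc_le_one`, `norm_QpCubeY_apply_le`, `QpsCubeY_apply`,
  `norm_QpsCubeY_apply_le`);
* §2 ★ `hasMajorantHom_conjHom_QpCubeY` ∕ ★ `hasMajorantHom_conjHom_QpsCubeY` — the binders `hQc`, `hQcs` at `(geoCK i □, blkCubeY i □, Prod.fst)` with `κ_Q = M₂Σ_j‖b_j‖`,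
  for EVERY field `U` with contractive transporters (so also the (3.57) letters `Q′_□(Ṽ)`, `Q′_□\*(Ṽ)` themselves);
* §3 ★★ `hasMajorant_conj_cube_sandwich` (generic block-local sandwich at the cube geometry), ★★ `hasMajorant_conj_QpCubeY_sandwich_QpsCubeY`, and ★★
  `hasMajorant_conj_XCubeY_of_site`: `conj b (s•(Q′_□G′_□²Q′_□\*)(U)) ≺ (M₂Σ‖b‖)²·K` on the cube blocks from `conj b (s•G′_□(U)²) ≺ K` on the sites — the `X̂`-rows
  input of the truncation part of p21's defect (FILE E2-3b) and the product letter of Theorem 3.2 at the cube.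

HONEST SCOPE.  Finite bookkeeping of [4] (2.51)-majorants for r05's DEFINED letters over p33's DEFINED geometry; NO estimate of [B9] is proved (the site majorant of
`G′_□²` is a HYPOTHESIS — Sect. B at the cube, p33's FILE 6).  The transporter hypothesis `hpar` (contraction of `parS U z w` and its inverse) holds for def-Y's
`parSymY` at unitary-type fields (`B9SectBGpLettersY.norm_le_one_and_inv_of_mem`), not asserted here.  Count-neutral; no summit ∕ sub-problem statement is proved;
nothing continuum ∕ OS ∕ mass-gap ∕ Clay.  No `sorry`, no `axiom`, no `… : Prop` fact, no `instance`, no `notation`, no `def`.  NEW file; nothing landed is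
modified.  Cell `lit-balaban`, seat `lit-balaban-p21` gen 34, 2026-08-28; `--supports stmt-QuantumFields-19200` as helper.  Net new unproved facts: 0.

RELATED IN THE TREE, NOT DUPLICATED (searched 2026-08-28): p21 `B9Thm39CinvSandwichQ` (the MEMBER's `Q′(U)`, `Q′\*(U)` over `geo9K i` — same mechanism, other letters
and geometry; not imported); r06 `B9Thm34InvBlk` (the consumer clause; not imported here), `B9Ineq349Hom` (`hasMajorantHom_comp_local ∕ _local_comp`), pv08
`B6RandomWalkHom` (`HasMajorantHom`); T9∕p21 `B9Eq352DivFormLetters` (`conj`, `coordEquiv`), `B9Eq376POneLetters` (`conjHom`); p33 `B9CubeGeometryInputs` (`geoCK`),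
`B9Cor35GpCubeInputsAtOne`, `B9Eq360DeltaPrimeACubeY` (`blkCubeY`); r05 `B9CubeLettersBondOpsL0` (`QpCubeY`, `QpsCubeY`, `XCubeY`, `qpKc`, `qpsKc`, `qpTc`), `B9Eq357CubeLetters` (`qpKc_of_blkOf_eq ∕ _ne`, `blkOf_of_qpKc_ne_zero`); N03∕r05
`B6Ineq268MultiLevelBoxL0` (`W`, `card_blkOf_le`) — USED BY NAME; no existing module modified.
-/

noncomputable section

namespace Literature.MathematicalPhysics.QuantumFieldTheory.Balaban1983to89.B9Cor36CubeSandwichQ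

open B6KLevelCensusIndexV1 (KIdx)
open B6Cover236MultiLevelBlocks (cubes)
open B6RandomWalk (HasMajorant BlockSupp hasMajorant_mono)
open B6RandomWalkHom (HasMajorantHom hasMajorantHom_mono hasMajorantHom_iff)
open B9Thm34Ext (toB6)
open B9Eq39Adjoint (R R_zero)
open B9Eq352DivFormLetters (coordEquiv conj conj_apply coordEquiv_apply coordEquiv_symm_apply norm_coordSymm_apply_le)
open B9Eq376POneLetters (conjHom conjHom_apply conjHom_comp conjHom_eq_conj)
open B9Ineq349Hom (hasMajorantHom_local_comp hasMajorantHom_comp_local)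
open B6Ineq268MultiLevelBoxL0 (W W_pos card_blkOf_le)
open B6Geom246MultiLevelBoxL0 (blkOf)
open B9Eq360Vprime (norm_R_le_of_unit)
open B9CubeLettersOpsL0 (cubeFamY GpCubeY)
open B9CubeLettersBondOpsL0 (BlkCubeY qpKc qpsKc qpTc blkCornerCubeY QpCubeY QpsCubeY XCubeY)
open B9Eq360DeltaPrimeACubeY (blkCubeY blkCubeY_apply)
open B9CubeGeometryInputs (geoCK)
open B9Eq357CubeLetters (qpKc_of_blkOf_eq qpKc_of_blkOf_ne blkOf_of_qpKc_ne_zero)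
open Node00 (SiteY CfgY SiteParY SiteOpY toKT trLiftY trLiftY_apply)

variable {d ℓ : ℕ} {hd : 1 ≤ d + 1} {hL : Odd (ℓ + 1) ∧ 1 < ℓ + 1} {b₀ b₁ : ℝ}
variable {𝔸 : Type} [NormedRing 𝔸] [NormedAlgebra ℂ 𝔸] [CompleteSpace 𝔸]
variable {ι : Type} [Fintype ι]
variable (i : KIdx d ℓ hd hL b₀ b₁) (c : ↥(cubes (toKT i).D.toDomains)) (b : Module.Basis ι ℝ 𝔸)

/-! ## §1 The letters `Q′_□(U)`, `Q′_□*(U)` pointwise: block-locality and contraction -/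

section Letters

variable (parS : SiteParY 𝔸 i) (U : CfgY 𝔸 i)

omit [NormedRing 𝔸] [NormedAlgebra ℂ 𝔸] [CompleteSpace 𝔸] in
/-- `Σ_z |q′_□(s, z)| ≦ 1` (the block average is a sub-probability: `#Δ(s)·W(s)⁻¹ ≦ 1`). [cite: Balaban1984PropagatorsII, (2.14) p.225 + (2.69) p.235, bookkeeping] -/
theorem sum_abs_qpKc_le_one (s : BlkCubeY i c) : ∑ z, |qpKc i c s z| ≤ 1 := by
  classical
  have hW := W_pos (cubeFamY i c).toDomains s
  have h1 : ∑ z, |qpKc i c s z| =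
      ((Finset.univ.filter fun z : SiteY i => blkOf (cubeFamY i c).toDomains z = s).card : ℝ) * (W (cubeFamY i c).toDomains s)⁻¹ := by
    rw [Finset.card_eq_sum_ones, Nat.cast_sum, Finset.sum_mul, Finset.sum_filter]
    refine Finset.sum_congr rfl fun z _ => ?_
    by_cases hz : blkOf (cubeFamY i c).toDomains z = s
    · rw [if_pos hz, qpKc_of_blkOf_eq i c hz, abs_of_nonneg (inv_nonneg.2 hW.le), Nat.cast_one, one_mul]
    · rw [if_neg hz, qpKc_of_blkOf_ne i c hz, abs_zero]
  rw [h1, ← div_eq_mul_inv, div_le_one hW]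
  exact card_blkOf_le (cubeFamY i c).toDomains s

/-- ★ **`Q′_□(U)` IS BLOCK-LOCAL**: if `Λ` vanishes on `Δ(s)` then `(Q′_□(U)Λ)(s) = 0`. [cite: Balaban1985BackgroundPropagators, (3.21) p.394; Balaban1984PropagatorsII, (2.14) p.225] -/
theorem QpCubeY_apply_eq_zero_of (Λ : SiteY i → 𝔸) (s : BlkCubeY i c) (hΛ : ∀ z, blkOf (cubeFamY i c).toDomains z = s → Λ z = 0) :
    QpCubeY i c parS U Λ s = 0 := by
  rw [QpCubeY, trLiftY_apply]
  refine Finset.sum_eq_zero fun z _ => ?_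
  by_cases hq : qpKc i c s z = 0
  · rw [hq, Complex.ofReal_zero, zero_smul]
  · rw [hΛ z (blkOf_of_qpKc_ne_zero i c hq), R_zero, smul_zero]

/-- ★ **`Q′_□(U)` IS A CONTRACTION IN THE BLOCK SUP** (contractive transporters): `‖Λ(z)‖ ≦ B` on `Δ(s)` ⇒ `‖(Q′_□(U)Λ)(s)‖ ≦ B`.
[cite: Balaban1985BackgroundPropagators, (3.21) p.394; Balaban1984PropagatorsII, (2.14) p.225] -/
theorem norm_QpCubeY_apply_le (hpar : ∀ z w : SiteY i, ‖(parS U z w : 𝔸)‖ ≤ 1 ∧ ‖(((parS U z w)⁻¹ : 𝔸ˣ) : 𝔸)‖ ≤ 1)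
    (Λ : SiteY i → 𝔸) (s : BlkCubeY i c) {B : ℝ} (hB : 0 ≤ B) (hΛ : ∀ z, blkOf (cubeFamY i c).toDomains z = s → ‖Λ z‖ ≤ B) :
    ‖QpCubeY i c parS U Λ s‖ ≤ B := by
  rw [QpCubeY, trLiftY_apply]
  have hterm : ∀ z : SiteY i, ‖(((qpKc i c s z : ℝ)) : ℂ) • R (qpTc i c parS U s z) (Λ z)‖ ≤ |qpKc i c s z| * B := by
    intro z
    rw [norm_smul, Complex.norm_real, Real.norm_eq_abs]
    by_cases hq : qpKc i c s z = 0
    · rw [hq, abs_zero, zero_mul, zero_mul]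
    · exact mul_le_mul_of_nonneg_left ((norm_R_le_of_unit _ _ (hpar _ _)).trans (hΛ z (blkOf_of_qpKc_ne_zero i c hq))) (abs_nonneg _)
  calc ‖∑ z, (((qpKc i c s z : ℝ)) : ℂ) • R (qpTc i c parS U s z) (Λ z)‖
      ≤ ∑ z, |qpKc i c s z| * B := (norm_sum_le _ _).trans (Finset.sum_le_sum fun z _ => hterm z)
    _ = (∑ z, |qpKc i c s z|) * B := by rw [Finset.sum_mul]
    _ ≤ 1 * B := mul_le_mul_of_nonneg_right (sum_abs_qpKc_le_one i c s) hB
    _ = B := one_mul B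

/-- ★ **`Q′_□*(U)` EVALUATED**: `(Q′_□*(U)λ)(z) = R(τ(s_z, z)⁻¹)λ(s_z)`, `s_z` the cube block of `z`. [cite: Balaban1985BackgroundPropagators, (3.24)–(3.25) p.394; Balaban1984PropagatorsII, (2.16) p.225] -/
theorem QpsCubeY_apply (lam : BlkCubeY i c → 𝔸) (z : SiteY i) :
    QpsCubeY i c parS U lam z = R (qpTc i c parS U (blkOf (cubeFamY i c).toDomains z) z)⁻¹ (lam (blkOf (cubeFamY i c).toDomains z)) := by
  rw [QpsCubeY, trLiftY_apply, Finset.sum_eq_single (blkOf (cubeFamY i c).toDomains z)]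
  · have hker : qpsKc i c z (blkOf (cubeFamY i c).toDomains z) = 1 := if_pos rfl
    rw [hker, Complex.ofReal_one, one_smul]
  · intro s _ hs
    have hker : qpsKc i c z s = 0 := if_neg (Ne.symm hs)
    rw [hker, Complex.ofReal_zero, zero_smul]
  · intro h; exact absurd (Finset.mem_univ _) h

/-- ★ **`Q′_□*(U)` IS A CONTRACTION** (contractive transporters): `‖(Q′_□*(U)λ)(z)‖ ≦ ‖λ(s_z)‖`. [cite: Balaban1985BackgroundPropagators, (3.24)–(3.25) p.394; Balaban1984PropagatorsII, (2.16) p.225] -/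
theorem norm_QpsCubeY_apply_le (hpar : ∀ z w : SiteY i, ‖(parS U z w : 𝔸)‖ ≤ 1 ∧ ‖(((parS U z w)⁻¹ : 𝔸ˣ) : 𝔸)‖ ≤ 1)
    (lam : BlkCubeY i c → 𝔸) (z : SiteY i) : ‖QpsCubeY i c parS U lam z‖ ≤ ‖lam (blkOf (cubeFamY i c).toDomains z)‖ := by
  rw [QpsCubeY_apply]
  obtain ⟨h1, h2⟩ := hpar (blkCornerCubeY i c (blkOf (cubeFamY i c).toDomains z)) z
  refine norm_R_le_of_unit _ _ ⟨h2, ?_⟩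
  rw [inv_inv]; exact h1

end Letters

/-! ## §2 The two letters in real coordinates: block-local two-space majorants between the site carrier and the cube-block carrier -/

section Coordinates

variable {Rr : ℝ} {Hp : Prop} (parS : SiteParY 𝔸 i) (U : CfgY 𝔸 i)

/-- ★ **`Q′_□(U)` IN REAL COORDINATES IS BLOCK-LOCAL WITH NORM `M₂Σ_j‖b_j‖`** over p33's cube geometry: `conjHom b Q′_□(U)` has the two-space majorant
`𝟙[a = a′]·M₂Σ_j‖b_j‖` from the site carrier (block map `(z, j) ↦ blkCubeY z`) to the cube-block carrier (`(s, j) ↦ s`) — the binder `hQc` of r06's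
`thm34_Cinv_uniform_blk` at the cube, for every field with contractive transporters. [cite: Balaban1985BackgroundPropagators, (3.21) p.394 + (3.57) p.401 + Thm 3.4 p.400; Balaban1984PropagatorsII, (2.51) p.232 + (2.14) p.225] -/
theorem hasMajorantHom_conjHom_QpCubeY (hpar : ∀ z w : SiteY i, ‖(parS U z w : 𝔸)‖ ≤ 1 ∧ ‖(((parS U z w)⁻¹ : 𝔸ˣ) : 𝔸)‖ ≤ 1)
    {M₂ : ℝ} (hM₂ : 0 ≤ M₂) (hrepr : ∀ (v : 𝔸) (j : ι), |b.repr v j| ≤ M₂ * ‖v‖) :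
    HasMajorantHom (g := toB6 (geoCK i c) Rr Hp) (fun p : SiteY i × ι => blkCubeY i c p.1) (fun q : BlkCubeY i c × ι => q.1)
      (conjHom b ((QpCubeY i c parS U).restrictScalars ℝ)) (fun a a' : BlkCubeY i c => if a = a' then M₂ * ∑ j, ‖b j‖ else 0) := by
  intro y' μ B hμ q
  rw [conjHom_apply, LinearMap.restrictScalars_apply]
  dsimp only
  split_ifs with hq
  · -- the block `q.1` IS the source block: contraction of the block average
    have hbd : ∀ p : SiteY i × ι, blkOf (cubeFamY i c).toDomains p.1 = q.1 → |μ p| ≤ B := fun p hp =>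
      hμ.bound p (by rw [blkCubeY_apply, hp, hq])
    have hSb : 0 ≤ (∑ j, ‖b j‖) * B := mul_nonneg (Finset.sum_nonneg fun j _ => norm_nonneg _) hμ.nonneg
    have h1 : ‖QpCubeY i c parS U ((coordEquiv b).symm μ) q.1‖ ≤ (∑ j, ‖b j‖) * B :=
      norm_QpCubeY_apply_le i c parS U hpar _ q.1 hSb fun z hz => norm_coordSymm_apply_le b μ z B fun j => hbd (z, j) hz
    calc |b.repr (QpCubeY i c parS U ((coordEquiv b).symm μ) q.1) q.2|
        ≤ M₂ * ‖QpCubeY i c parS U ((coordEquiv b).symm μ) q.1‖ := hrepr _ _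
      _ ≤ M₂ * ((∑ j, ‖b j‖) * B) := mul_le_mul_of_nonneg_left h1 hM₂
      _ = M₂ * (∑ j, ‖b j‖) * B := by ring
  · -- a different block: the argument vanishes on `Δ(q.1)`, so does the average
    have h0 : QpCubeY i c parS U ((coordEquiv b).symm μ) q.1 = 0 := by
      refine QpCubeY_apply_eq_zero_of i c parS U _ q.1 fun z hz => ?_
      rw [coordEquiv_symm_apply]
      refine Finset.sum_eq_zero fun j _ => ?_
      rw [hμ.off (z, j) (fun h => hq (by rw [← h, blkCubeY_apply, hz])), zero_smul]
    rw [h0, map_zero, Finsupp.zero_apply, abs_zero, zero_mul]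

/-- ★ **`Q′_□*(U)` IN REAL COORDINATES IS BLOCK-LOCAL WITH NORM `M₂Σ_j‖b_j‖`** over p33's cube geometry — the binder `hQcs` of r06's `thm34_Cinv_uniform_blk` at the cube.
[cite: Balaban1985BackgroundPropagators, (3.24)–(3.25) p.394 + (3.57) p.401 + Thm 3.4 p.400; Balaban1984PropagatorsII, (2.51) p.232 + (2.16) p.225] -/
theorem hasMajorantHom_conjHom_QpsCubeY (hpar : ∀ z w : SiteY i, ‖(parS U z w : 𝔸)‖ ≤ 1 ∧ ‖(((parS U z w)⁻¹ : 𝔸ˣ) : 𝔸)‖ ≤ 1)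
    {M₂ : ℝ} (hM₂ : 0 ≤ M₂) (hrepr : ∀ (v : 𝔸) (j : ι), |b.repr v j| ≤ M₂ * ‖v‖) :
    HasMajorantHom (g := toB6 (geoCK i c) Rr Hp) (fun q : BlkCubeY i c × ι => q.1) (fun p : SiteY i × ι => blkCubeY i c p.1)
      (conjHom b ((QpsCubeY i c parS U).restrictScalars ℝ)) (fun a a' : BlkCubeY i c => if a = a' then M₂ * ∑ j, ‖b j‖ else 0) := by
  intro y' μ B hμ p
  rw [conjHom_apply, LinearMap.restrictScalars_apply]
  dsimp only
  rw [blkCubeY_apply]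
  split_ifs with hp
  · have h1 : ‖QpsCubeY i c parS U ((coordEquiv b).symm μ) p.1‖ ≤ (∑ j, ‖b j‖) * B :=
      (norm_QpsCubeY_apply_le i c parS U hpar _ p.1).trans
        (norm_coordSymm_apply_le b μ (blkOf (cubeFamY i c).toDomains p.1) B fun j => hμ.bound (blkOf (cubeFamY i c).toDomains p.1, j) hp)
    calc |b.repr (QpsCubeY i c parS U ((coordEquiv b).symm μ) p.1) p.2|
        ≤ M₂ * ‖QpsCubeY i c parS U ((coordEquiv b).symm μ) p.1‖ := hrepr _ _
      _ ≤ M₂ * ((∑ j, ‖b j‖) * B) := mul_le_mul_of_nonneg_left h1 hM₂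
      _ = M₂ * (∑ j, ‖b j‖) * B := by ring
  · have h0 : QpsCubeY i c parS U ((coordEquiv b).symm μ) p.1 = 0 := by
      rw [QpsCubeY_apply, coordEquiv_symm_apply]
      have hs : ∑ j, μ (blkOf (cubeFamY i c).toDomains p.1, j) • b j = 0 :=
        Finset.sum_eq_zero fun j _ => by rw [hμ.off (blkOf (cubeFamY i c).toDomains p.1, j) hp, zero_smul]
      rw [hs, R_zero]
    rw [h0, map_zero, Finsupp.zero_apply, abs_zero, zero_mul]

end Coordinates

/-! ## §3 ★★ The `Q′_□( · )Q′_□*` sandwich over the cube geometry -/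

section Sandwich

variable {Rr : ℝ} {Hp : Prop}

omit [CompleteSpace 𝔸] in
/-- ★★ **THE BLOCK-LOCAL SANDWICH AT THE CUBE GEOMETRY, GENERIC** ([4] (2.52) twice through the site carrier): ℝ-linear letters `Qr : (sites → 𝔸) → (cube blocks → 𝔸)`
and `Qsr : (cube blocks → 𝔸) → (sites → 𝔸)` block-local in real coordinates with diagonal majorants `κ₁𝟙`, `κ₂𝟙` (`κ₂ ≧ 0`), and a site letter `T` with
`conj b T ≺ K` (`K ≧ 0`, block map `(z, j) ↦ blkCubeY z`) give `conj b (Qr ∘ T ∘ Qsr) ≺ κ₁κ₂·K` on the cube-block carrier (block map `(s, j) ↦ s`).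
[cite: Balaban1984PropagatorsII, (2.52) p.232; Balaban1985BackgroundPropagators, (3.25) p.394, p.409 l.2–5] -/
theorem hasMajorant_conj_cube_sandwich {κ₁ κ₂ : ℝ} (hκ₂ : 0 ≤ κ₂)
    {Qr : (SiteY i → 𝔸) →ₗ[ℝ] (BlkCubeY i c → 𝔸)} {Qsr : (BlkCubeY i c → 𝔸) →ₗ[ℝ] (SiteY i → 𝔸)} {T : Module.End ℝ (SiteY i → 𝔸)}
    {K : BlkCubeY i c → BlkCubeY i c → ℝ} (hK : ∀ a a', 0 ≤ K a a')
    (hQ : HasMajorantHom (g := toB6 (geoCK i c) Rr Hp) (fun p : SiteY i × ι => blkCubeY i c p.1) (fun q : BlkCubeY i c × ι => q.1)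
      (conjHom b Qr) (fun a a' : BlkCubeY i c => if a = a' then κ₁ else 0))
    (hQs : HasMajorantHom (g := toB6 (geoCK i c) Rr Hp) (fun q : BlkCubeY i c × ι => q.1) (fun p : SiteY i × ι => blkCubeY i c p.1)
      (conjHom b Qsr) (fun a a' : BlkCubeY i c => if a = a' then κ₂ else 0))
    (hT : HasMajorant (g := toB6 (geoCK i c) Rr Hp) (fun p : SiteY i × ι => blkCubeY i c p.1) (conj b T) K) :
    HasMajorant (g := toB6 (geoCK i c) Rr Hp) (fun q : BlkCubeY i c × ι => q.1) (conj b (Qr ∘ₗ T ∘ₗ Qsr))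
      (fun a a' => κ₁ * κ₂ * K a a') := by
  classical
  have hrw : conj b (Qr ∘ₗ T ∘ₗ Qsr) = conjHom b Qr ∘ₗ (conj b T ∘ₗ conjHom b Qsr) := by
    rw [← conjHom_eq_conj, ← conjHom_eq_conj, conjHom_comp, conjHom_comp]
  rw [hrw]
  have hT' : HasMajorantHom (g := toB6 (geoCK i c) Rr Hp) (fun p : SiteY i × ι => blkCubeY i c p.1)
      (fun p : SiteY i × ι => blkCubeY i c p.1) (conj b T) K := (hasMajorantHom_iff (g := toB6 (geoCK i c) Rr Hp) _ _ _).mpr hT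
  have h1 := hasMajorantHom_comp_local (g := geoCK i c) (R := Rr) (H := Hp) (fun q : BlkCubeY i c × ι => q.1)
    (fun p : SiteY i × ι => blkCubeY i c p.1) (fun p : SiteY i × ι => blkCubeY i c p.1) κ₂ hκ₂ hT' hQs
  have h2 := hasMajorantHom_local_comp (g := geoCK i c) (R := Rr) (H := Hp) (fun q : BlkCubeY i c × ι => q.1)
    (fun p : SiteY i × ι => blkCubeY i c p.1) (fun q : BlkCubeY i c × ι => q.1) κ₁ (fun a a' => mul_nonneg (hK a a') hκ₂) hQ h1
  exact (hasMajorantHom_iff (g := toB6 (geoCK i c) Rr Hp) _ _ _).mp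
    (hasMajorantHom_mono (g := toB6 (geoCK i c) Rr Hp) _ _ h2 fun a a' => le_of_eq (by ring))

variable (parS : SiteParY 𝔸 i) (U : CfgY 𝔸 i)

/-- ★★ **THE `Q′_□(U)( · )Q′_□*(U)` SANDWICH AT r05's LETTERS**: for contractive transporters and a real basis with coordinate bound `M₂`, a site letter `T` with
`conj b T ≺ K` (`K ≧ 0`) gives `conj b (Q′_□(U) ∘ T ∘ Q′_□*(U)) ≺ (M₂Σ_j‖b_j‖)²·K` on the cube-block carrier.
[cite: Balaban1985BackgroundPropagators, (3.21) p.394 + (3.24)–(3.25) p.394 + p.409 l.2–5; Balaban1984PropagatorsII, (2.52) p.232] -/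
theorem hasMajorant_conj_QpCubeY_sandwich_QpsCubeY (hpar : ∀ z w : SiteY i, ‖(parS U z w : 𝔸)‖ ≤ 1 ∧ ‖(((parS U z w)⁻¹ : 𝔸ˣ) : 𝔸)‖ ≤ 1)
    {M₂ : ℝ} (hM₂ : 0 ≤ M₂) (hrepr : ∀ (v : 𝔸) (j : ι), |b.repr v j| ≤ M₂ * ‖v‖)
    {T : Module.End ℝ (SiteY i → 𝔸)} {K : BlkCubeY i c → BlkCubeY i c → ℝ} (hK : ∀ a a', 0 ≤ K a a')
    (hT : HasMajorant (g := toB6 (geoCK i c) Rr Hp) (fun p : SiteY i × ι => blkCubeY i c p.1) (conj b T) K) :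
    HasMajorant (g := toB6 (geoCK i c) Rr Hp) (fun q : BlkCubeY i c × ι => q.1)
      (conj b ((QpCubeY i c parS U).restrictScalars ℝ ∘ₗ T ∘ₗ (QpsCubeY i c parS U).restrictScalars ℝ))
      (fun a a' => (M₂ * ∑ j, ‖b j‖) ^ 2 * K a a') := by
  have h := hasMajorant_conj_cube_sandwich i c b (Rr := Rr) (Hp := Hp) (mul_nonneg hM₂ (Finset.sum_nonneg fun j _ => norm_nonneg (b j))) hK
    (hasMajorantHom_conjHom_QpCubeY i c b parS U hpar hM₂ hrepr) (hasMajorantHom_conjHom_QpsCubeY i c b parS U hpar hM₂ hrepr) hT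
  exact hasMajorant_mono (g := toB6 (geoCK i c) Rr Hp) _ h fun a a' => le_of_eq (by ring)

variable (Gp : SiteOpY 𝔸 i)

omit [Fintype ι] in
/-- `s•(Q′_□G′_□²Q′_□*)(U)` restricted to real scalars is the word `Q′_□ ∘ (s•(G′_□·G′_□)) ∘ Q′_□*` of ℝ-linear letters (r05's `XCubeY` unfolded; the scale weight moved
to the middle factor). [cite: Balaban1985BackgroundPropagators, (3.25) p.394, p.409 l.2–5, dictionary] -/
theorem smul_XCubeY_restrictScalars (s : ℝ) :
    s • (XCubeY i c parS U).restrictScalars ℝ =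
      (QpCubeY i c parS U).restrictScalars ℝ ∘ₗ
        (s • ((GpCubeY i c parS U).restrictScalars ℝ * (GpCubeY i c parS U).restrictScalars ℝ)) ∘ₗ (QpsCubeY i c parS U).restrictScalars ℝ := by
  rw [LinearMap.smul_comp, LinearMap.comp_smul]
  rfl

/-- ★★ **THE BLOCK MAJORANT OF `s•(Q′_□G′_□²Q′_□*)(U)` FROM THE SITE MAJORANT OF `s•G′_□(U)²`**: if `conj b (s•(G′_□·G′_□)) ≺ K` on the site carrier (`K ≧ 0`; block
map `(z, j) ↦ blkCubeY z`), then `conj b (s•XCubeY i □ parS U) ≺ (M₂Σ_j‖b_j‖)²·K` on the cube-block carrier — the `X̂`-rows of the truncation part of p21's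
defect (FILE E2-3b) and the direct letter of Theorem 3.2 at the cube. [cite: Balaban1985BackgroundPropagators, (3.25) p.394 + p.409 l.2–5 + (3.95) p.411; Balaban1984PropagatorsII, (2.83) p.237 + (2.52) p.232] -/
theorem hasMajorant_conj_XCubeY_of_site (hpar : ∀ z w : SiteY i, ‖(parS U z w : 𝔸)‖ ≤ 1 ∧ ‖(((parS U z w)⁻¹ : 𝔸ˣ) : 𝔸)‖ ≤ 1)
    {M₂ : ℝ} (hM₂ : 0 ≤ M₂) (hrepr : ∀ (v : 𝔸) (j : ι), |b.repr v j| ≤ M₂ * ‖v‖) (s : ℝ)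
    {K : BlkCubeY i c → BlkCubeY i c → ℝ} (hK : ∀ a a', 0 ≤ K a a')
    (hGG : HasMajorant (g := toB6 (geoCK i c) Rr Hp) (fun p : SiteY i × ι => blkCubeY i c p.1)
      (conj b (s • ((GpCubeY i c parS U).restrictScalars ℝ * (GpCubeY i c parS U).restrictScalars ℝ))) K) :
    HasMajorant (g := toB6 (geoCK i c) Rr Hp) (fun q : BlkCubeY i c × ι => q.1) (conj b (s • (XCubeY i c parS U).restrictScalars ℝ))
      (fun a a' => (M₂ * ∑ j, ‖b j‖) ^ 2 * K a a') := by
  rw [smul_XCubeY_restrictScalars]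
  exact hasMajorant_conj_QpCubeY_sandwich_QpsCubeY i c b parS U hpar hM₂ hrepr hK hGG

end Sandwich

end Literature.MathematicalPhysics.QuantumFieldTheory.Balaban1983to89.B9Cor36CubeSandwichQ

end
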